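import Literature.Geometry.Lorentzian.KerrStarHorizonCurrent
import HarnessLib

/-!
# Barrier catalogue `FinalStateConjecture`: the cut-off `N`-current of Aretakis's §13.1 —
# pointwise algebra (congruence under local modification of the profiles, the `T`-tail,
# quadratic-form bounds in the transition region, sign and coercivity on the collar)
# (`Literature/Barriers/FinalStateConjecture/`, D-0021, D-0014; family `gr`)

Written from the proving seat of
`Literature.Barriers.FinalStateConjecture.Aretakis2012_uniformBoundedness` (Aretakis, JFA 263
(2012), Thm. 2). The printed proof (§13.1) applies Stokes' theorem to the current
`J^{N,δ,−1/2} = J^N − ½δψ∇ψ`, where `N` is Aretakis's vector field near `𝓗⁺` (§7.2; tree: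
`KerrStarHorizonCurrent.lean`, profiles `nProfileR`, `nProfileT`, `nProfileW` of the multiplier
`f∂_r + h∂_{t*}` with Lagrangian coefficient `w`), "extended so that `N = T` for `r ≥ r_e + M/23`",
and `δ` is a cut-off equal to `1` on `[M, r_e]` and `0` beyond `r_e + M/23`. In the vocabulary of
`KerrStarMultiplierIdentity.lean` the extended, cut-off current is the multiplier with profiles
`(χ·N^Y, χ·(N^T − N^Y) + (1 − χ), χ·(−½))` for a smooth `χ` which is `1` near `[M, A]` and `0`
near `[B, ∞)`. This file supplies the POINTWISE facts about such profiles used in §13.1: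

* `multBulk_congr_nhds`, `multDensity_congr`, `multFluxR_congr_nhds` — the bulk, density and
  radial flux at a point `q` depend on the profiles only through their germs at `r = q 1`
  (so on the collar they are those of `N`, and beyond `B` those of `T`);
* `multBulk_T`, `multDensity_T` — for the profiles `(0, 1, 0)` of `T = ∂_{t*}` the bulk vanishes
  (`K^T = 0`, `T` Killing) and the density is `−e_T`;
* `multBulk_eq_quadratic`, `multDensity_eq_quadratic`, `abs_quadratic₅_le`, `abs_quadratic₇_le`,
  `exists_bound_multBulk`, `exists_bound_multBulk_le` (one-sided, without the angular derivative,
  when its coefficient `½f' − w` is `≤ 0`), `exists_bound_multDensity` — in a transition region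
  `A ≤ r ≤ B` the bulk
  and the density are `sin θ` times quadratic forms in `(∂_{t*}G, ∂_rG, ∂_θG, G)` with continuous
  coefficients, hence bounded by `K sin θ ((∂_{t*}G)² + (∂_rG)² + (∂_θG)² + G²)` ("we can bound
  all the error terms in the intermediate region", §13.1);
* `multBulk_nCurrent_nonpos`, `nEnergy_collar_ge` — on the collar `M ≤ r ≤ 23M/21` the bulk of
  `J^{N,−1/2}` is `≤ 0` (Prop. 7.2.1, `KerrStarHorizonCurrent.neg_multBulk_nCurrent_ge`) and its
  density controls `(M³/16) sin θ (∂_rG)²` up to `C_M sin θ G²` and `C_M e_T` (the zeroth-order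
  terms being "applications of the first Hardy inequality", §13.1).

Everything is proved; no definitions, no named facts (D-0026).

## References

* S. Aretakis, *Decay of axisymmetric solutions of the wave equation on extreme Kerr
  backgrounds*, J. Funct. Anal. 263 (2012) 2770–2831 (arXiv:1110.2006): §7.2 (the field `N`,
  Prop. 7.2.1), §13.1 (the cut-off current `J^{N,δ,−1/2}` and the proof of Thm. 2).
  [Aretakis2012]
-/

noncomputable section

open Real Set Filter
open scoped Topology ContDiff

namespace Literature.Barriers.FinalStateConjecture.Kerr

open Literature.Geometry.Lorentzian Literature.Geometry.Lorentzian.Kerr.StarCoord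

/-! ### Locality of the densities in the profiles -/

/-- The bulk at `q` depends on the profiles only through their germs at `r = q 1`. [folklore] -/
theorem multBulk_congr_nhds {M a : ℝ} {f₁ f₂ h₁ h₂ w₁ w₂ : ℝ → ℝ} {G : E4 → ℝ} {q : E4}
    (hf : f₁ =ᶠ[𝓝 (q 1)] f₂) (hh : h₁ =ᶠ[𝓝 (q 1)] h₂) (hw : w₁ =ᶠ[𝓝 (q 1)] w₂) :
    multBulk M a f₁ h₁ w₁ G q = multBulk M a f₂ h₂ w₂ G q := by
  simp only [multBulk, radMultBulk, lagBulk, hf.eq_of_nhds, hf.deriv_eq, hh.deriv_eq, hw.eq_of_nhds,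
    hw.deriv_eq, hw.deriv.deriv_eq]

/-- The density at `q` depends only on the values of the profiles at `r = q 1`. [folklore] -/
theorem multDensity_congr {M a : ℝ} {f₁ f₂ h₁ h₂ w₁ w₂ : ℝ → ℝ} {G : E4 → ℝ} {q : E4}
    (hf : f₁ (q 1) = f₂ (q 1)) (hh : h₁ (q 1) = h₂ (q 1)) (hw : w₁ (q 1) = w₂ (q 1)) :
    multDensity M a f₁ h₁ w₁ G q = multDensity M a f₂ h₂ w₂ G q := by
  simp only [multDensity, radMultDensity, timeMultDensity, lagDensity, hf, hh, hw]

/-- The radial flux at `q` depends on `f, h` at `r = q 1` and on the germ of `w` there. [folklore] -/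
theorem multFluxR_congr_nhds {M a : ℝ} {f₁ f₂ h₁ h₂ w₁ w₂ : ℝ → ℝ} {G : E4 → ℝ} {q : E4}
    (hf : f₁ (q 1) = f₂ (q 1)) (hh : h₁ (q 1) = h₂ (q 1)) (hw : w₁ =ᶠ[𝓝 (q 1)] w₂) :
    multFluxR M a f₁ h₁ w₁ G q = multFluxR M a f₂ h₂ w₂ G q := by
  simp only [multFluxR, radMultFluxR, timeMultFluxR, lagFluxR, hf, hh, hw.eq_of_nhds, hw.deriv_eq]

/-! ### The tail: the profiles `(0, 1, 0)` of the Killing multiplier `T` -/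

/-- For the multiplier `T = ∂_{t*}` (profiles `f = 0`, `h = 1`, `w = 0`) the bulk vanishes
(`K^T = 0`). [cite: Aretakis2012, §5.1 (Prop. 5.1.2)] -/
theorem multBulk_T (M a : ℝ) (G : E4 → ℝ) (q : E4) :
    multBulk M a (fun _ ↦ 0) (fun _ ↦ 1) (fun _ ↦ 0) G q = 0 := by
  simp [multBulk, radMultBulk, lagBulk]

/-- For the multiplier `T` the density is `−e_T`. [cite: Aretakis2012, §5.1] -/
theorem multDensity_T (M a : ℝ) (G : E4 → ℝ) (q : E4) :
    multDensity M a (fun _ ↦ 0) (fun _ ↦ 1) (fun _ ↦ 0) G q = -tEnergy M a G q := by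
  simp [multDensity, radMultDensity, timeMultDensity, lagDensity]

/-! ### The bulk and the density as quadratic forms -/

/-- **The bulk as `sin θ` times a quadratic form** in `(∂_{t*}G, ∂_rG, ∂_θG, G)` with coefficients
built from `f, f', h', w, w', w''` at `r = q 1`, `Δ = r² − 2Mr + a²`, `Σ = r² + a²cos²θ + 2Mr`.
[cite: Aretakis2012, §8] -/
theorem multBulk_eq_quadratic (M a : ℝ) (f h w : ℝ → ℝ) (G : E4 → ℝ) (q : E4) :
    multBulk M a f h w G q = sin (q 2) *
      ((1 / 2 * (f (q 1) * (2 * q 1 - 2 * M) - deriv f (q 1) * (q 1 ^ 2 - 2 * M * q 1 + a ^ 2)) -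
          w (q 1) * (q 1 ^ 2 - 2 * M * q 1 + a ^ 2)) * pd 1 G q ^ 2 +
        (2 * M * f (q 1) - deriv h (q 1) * (q 1 ^ 2 - 2 * M * q 1 + a ^ 2) -
          4 * M * q 1 * w (q 1)) * pd 0 G q * pd 1 G q +
        (-(1 / 2 * (deriv f (q 1) * (q 1 ^ 2 + a ^ 2 * cos (q 2) ^ 2 + 2 * M * q 1) +
            f (q 1) * (2 * q 1 + 2 * M))) - deriv h (q 1) * (2 * M * q 1) +
          (q 1 ^ 2 + a ^ 2 * cos (q 2) ^ 2 + 2 * M * q 1) * w (q 1)) * pd 0 G q ^ 2 +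
        (1 / 2 * deriv f (q 1) - w (q 1)) * pd 2 G q ^ 2 +
        (1 / 2 * (deriv (deriv w) (q 1) * (q 1 ^ 2 - 2 * M * q 1 + a ^ 2) +
          deriv w (q 1) * (2 * q 1 - 2 * M))) * G q ^ 2) := by
  simp only [multBulk, radMultBulk, lagBulk, tFluxR]
  ring

/-- **The density as `sin θ` times a quadratic form** in `(∂_{t*}G, ∂_rG, ∂_θG, G)`.
[cite: Aretakis2012, §8] -/
theorem multDensity_eq_quadratic (M a : ℝ) (f h w : ℝ → ℝ) (G : E4 → ℝ) (q : E4) :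
    multDensity M a f h w G q = sin (q 2) *
      ((f (q 1) * (2 * M * q 1) - 1 / 2 * h (q 1) * (q 1 ^ 2 - 2 * M * q 1 + a ^ 2)) * pd 1 G q ^ 2 +
        (-(f (q 1) * (q 1 ^ 2 + a ^ 2 * cos (q 2) ^ 2 + 2 * M * q 1))) * pd 0 G q * pd 1 G q +
        (-(1 / 2 * h (q 1) * (q 1 ^ 2 + a ^ 2 * cos (q 2) ^ 2 + 2 * M * q 1))) * pd 0 G q ^ 2 +
        (-(1 / 2 * h (q 1))) * pd 2 G q ^ 2 +
        (4 * M * q 1 * w (q 1)) * G q * pd 1 G q +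
        (M * w (q 1)) * G q ^ 2 +
        (-((q 1 ^ 2 + a ^ 2 * cos (q 2) ^ 2 + 2 * M * q 1) * w (q 1))) * G q * pd 0 G q) := by
  simp only [multDensity, radMultDensity, timeMultDensity, lagDensity, tEnergy]
  ring

/-- A five-term quadratic form with coefficients bounded by `K` is bounded by
`2K (x² + y² + z² + g²)`. [folklore] -/
theorem abs_quadratic₅_le {c₁ c₂ c₃ c₄ c₅ K x y z g : ℝ} (h₁ : |c₁| ≤ K) (h₂ : |c₂| ≤ K)
    (h₃ : |c₃| ≤ K) (h₄ : |c₄| ≤ K) (h₅ : |c₅| ≤ K) :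
    |c₁ * y ^ 2 + c₂ * x * y + c₃ * x ^ 2 + c₄ * z ^ 2 + c₅ * g ^ 2| ≤
      2 * K * (x ^ 2 + y ^ 2 + z ^ 2 + g ^ 2) := by
  obtain ⟨h₁l, h₁u⟩ := abs_le.mp h₁
  obtain ⟨h₂l, h₂u⟩ := abs_le.mp h₂
  obtain ⟨h₃l, h₃u⟩ := abs_le.mp h₃
  obtain ⟨h₄l, h₄u⟩ := abs_le.mp h₄
  obtain ⟨h₅l, h₅u⟩ := abs_le.mp h₅
  rw [abs_le]
  constructor
  · nlinarith [mul_nonneg (by linarith : 0 ≤ K + c₁) (sq_nonneg y),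
      mul_nonneg (by linarith : 0 ≤ K - c₂) (sq_nonneg (x - y)),
      mul_nonneg (by linarith : 0 ≤ K + c₂) (sq_nonneg (x + y)),
      mul_nonneg (by linarith : 0 ≤ K + c₃) (sq_nonneg x),
      mul_nonneg (by linarith : 0 ≤ K + c₄) (sq_nonneg z),
      mul_nonneg (by linarith : 0 ≤ K + c₅) (sq_nonneg g)]
  · nlinarith [mul_nonneg (by linarith : 0 ≤ K - c₁) (sq_nonneg y),
      mul_nonneg (by linarith : 0 ≤ K - c₂) (sq_nonneg (x + y)),
      mul_nonneg (by linarith : 0 ≤ K + c₂) (sq_nonneg (x - y)),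
      mul_nonneg (by linarith : 0 ≤ K - c₃) (sq_nonneg x),
      mul_nonneg (by linarith : 0 ≤ K - c₄) (sq_nonneg z),
      mul_nonneg (by linarith : 0 ≤ K - c₅) (sq_nonneg g)]

/-- A seven-term quadratic form (three cross terms) with coefficients bounded by `K` is bounded by
`3K (x² + y² + z² + g²)`. [folklore] -/
theorem abs_quadratic₇_le {c₁ c₂ c₃ c₄ c₅ c₆ c₇ K x y z g : ℝ} (h₁ : |c₁| ≤ K) (h₂ : |c₂| ≤ K)
    (h₃ : |c₃| ≤ K) (h₄ : |c₄| ≤ K) (h₅ : |c₅| ≤ K) (h₆ : |c₆| ≤ K) (h₇ : |c₇| ≤ K) :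
    |c₁ * y ^ 2 + c₂ * x * y + c₃ * x ^ 2 + c₄ * z ^ 2 + c₅ * g * y + c₆ * g ^ 2 + c₇ * g * x| ≤
      3 * K * (x ^ 2 + y ^ 2 + z ^ 2 + g ^ 2) := by
  obtain ⟨h₁l, h₁u⟩ := abs_le.mp h₁
  obtain ⟨h₂l, h₂u⟩ := abs_le.mp h₂
  obtain ⟨h₃l, h₃u⟩ := abs_le.mp h₃
  obtain ⟨h₄l, h₄u⟩ := abs_le.mp h₄
  obtain ⟨h₅l, h₅u⟩ := abs_le.mp h₅
  obtain ⟨h₆l, h₆u⟩ := abs_le.mp h₆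
  obtain ⟨h₇l, h₇u⟩ := abs_le.mp h₇
  have hK : 0 ≤ K := (abs_nonneg _).trans h₁
  rw [abs_le]
  constructor
  · nlinarith [mul_nonneg (by linarith : 0 ≤ K + c₁) (sq_nonneg y),
      mul_nonneg (by linarith : 0 ≤ K - c₂) (sq_nonneg (x - y)),
      mul_nonneg (by linarith : 0 ≤ K + c₂) (sq_nonneg (x + y)),
      mul_nonneg (by linarith : 0 ≤ K + c₃) (sq_nonneg x),
      mul_nonneg (by linarith : 0 ≤ K + c₄) (sq_nonneg z),
      mul_nonneg (by linarith : 0 ≤ K - c₅) (sq_nonneg (g - y)),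
      mul_nonneg (by linarith : 0 ≤ K + c₅) (sq_nonneg (g + y)),
      mul_nonneg (by linarith : 0 ≤ K + c₆) (sq_nonneg g),
      mul_nonneg (by linarith : 0 ≤ K - c₇) (sq_nonneg (g - x)),
      mul_nonneg (by linarith : 0 ≤ K + c₇) (sq_nonneg (g + x)),
      mul_nonneg hK (sq_nonneg z), mul_nonneg hK (sq_nonneg x), mul_nonneg hK (sq_nonneg y),
      mul_nonneg hK (sq_nonneg g)]
  · nlinarith [mul_nonneg (by linarith : 0 ≤ K - c₁) (sq_nonneg y),
      mul_nonneg (by linarith : 0 ≤ K - c₂) (sq_nonneg (x + y)),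
      mul_nonneg (by linarith : 0 ≤ K + c₂) (sq_nonneg (x - y)),
      mul_nonneg (by linarith : 0 ≤ K - c₃) (sq_nonneg x),
      mul_nonneg (by linarith : 0 ≤ K - c₄) (sq_nonneg z),
      mul_nonneg (by linarith : 0 ≤ K - c₅) (sq_nonneg (g + y)),
      mul_nonneg (by linarith : 0 ≤ K + c₅) (sq_nonneg (g - y)),
      mul_nonneg (by linarith : 0 ≤ K - c₆) (sq_nonneg g),
      mul_nonneg (by linarith : 0 ≤ K - c₇) (sq_nonneg (g + x)),
      mul_nonneg (by linarith : 0 ≤ K + c₇) (sq_nonneg (g - x)),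
      mul_nonneg hK (sq_nonneg z), mul_nonneg hK (sq_nonneg x), mul_nonneg hK (sq_nonneg y),
      mul_nonneg hK (sq_nonneg g)]

/-! ### Bounds in a transition region `A ≤ r ≤ B` -/

/-- A jointly continuous function of `(r, θ)` is bounded on `[A, B] × [0, π]` by a non-negative
constant. [folklore] -/
theorem exists_abs_le_of_continuous {c : ℝ → ℝ → ℝ} (hc : Continuous (Function.uncurry c)) (A B : ℝ) :
    ∃ K : ℝ, 0 ≤ K ∧ ∀ r ∈ Icc A B, ∀ θ ∈ Icc 0 π, |c r θ| ≤ K := by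
  obtain ⟨C, hC⟩ := ((isCompact_Icc (a := A) (b := B)).prod (isCompact_Icc (a := (0 : ℝ)) (b := π))).exists_bound_of_continuousOn
    hc.continuousOn
  refine ⟨|C|, abs_nonneg _, fun r hr θ hθ ↦ ?_⟩
  have h := hC (r, θ) ⟨hr, hθ⟩
  rw [Function.uncurry_apply_pair, Real.norm_eq_abs] at h
  exact h.trans (le_abs_self C)

/-- **The bulk of a multiplier with smooth profiles is bounded, on `A ≤ r ≤ B`, `θ ∈ [0, π]`, by
`K sin θ ((∂_{t*}G)² + (∂_rG)² + (∂_θG)² + G²)`** ("we can bound all the error terms in the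
intermediate region", §13.1). [cite: Aretakis2012, §13.1] -/
theorem exists_bound_multBulk (M a A B : ℝ) {f h w : ℝ → ℝ} (hf : ContDiff ℝ ∞ f)
    (hh : ContDiff ℝ ∞ h) (hw : ContDiff ℝ ∞ w) :
    ∃ K : ℝ, 0 ≤ K ∧ ∀ (G : E4 → ℝ) (q : E4), q 1 ∈ Icc A B → q 2 ∈ Icc 0 π →
      |multBulk M a f h w G q| ≤
        K * (sin (q 2) * (pd 0 G q ^ 2 + pd 1 G q ^ 2 + pd 2 G q ^ 2 + G q ^ 2)) := by
  have cf : Continuous f := hf.continuous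
  have cfr : Continuous (deriv f) := (contDiff_infty_iff_deriv.mp hf).2.continuous
  have chr : Continuous (deriv h) := (contDiff_infty_iff_deriv.mp hh).2.continuous
  have cw : Continuous w := hw.continuous
  have hw' := (contDiff_infty_iff_deriv.mp hw).2
  have cwr : Continuous (deriv w) := hw'.continuous
  have cwrr : Continuous (deriv (deriv w)) := (contDiff_infty_iff_deriv.mp hw').2.continuous
  obtain ⟨K₁, h₁0, hK₁⟩ := exists_abs_le_of_continuous (c := fun r θ ↦
    1 / 2 * (f r * (2 * r - 2 * M) - deriv f r * (r ^ 2 - 2 * M * r + a ^ 2)) -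
      w r * (r ^ 2 - 2 * M * r + a ^ 2)) (by fun_prop) A B
  obtain ⟨K₂, h₂0, hK₂⟩ := exists_abs_le_of_continuous (c := fun r (θ : ℝ) ↦
    2 * M * f r - deriv h r * (r ^ 2 - 2 * M * r + a ^ 2) - 4 * M * r * w r) (by fun_prop) A B
  obtain ⟨K₃, h₃0, hK₃⟩ := exists_abs_le_of_continuous (c := fun r θ ↦
    -(1 / 2 * (deriv f r * (r ^ 2 + a ^ 2 * cos θ ^ 2 + 2 * M * r) + f r * (2 * r + 2 * M))) -
      deriv h r * (2 * M * r) + (r ^ 2 + a ^ 2 * cos θ ^ 2 + 2 * M * r) * w r) (by fun_prop) A B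
  obtain ⟨K₄, h₄0, hK₄⟩ := exists_abs_le_of_continuous (c := fun r (θ : ℝ) ↦
    1 / 2 * deriv f r - w r) (by fun_prop) A B
  obtain ⟨K₅, h₅0, hK₅⟩ := exists_abs_le_of_continuous (c := fun r (θ : ℝ) ↦
    1 / 2 * (deriv (deriv w) r * (r ^ 2 - 2 * M * r + a ^ 2) + deriv w r * (2 * r - 2 * M)))
    (by fun_prop) A B
  refine ⟨2 * (K₁ + K₂ + K₃ + K₄ + K₅), by positivity, fun G q hr hθ ↦ ?_⟩
  have hs : 0 ≤ sin (q 2) := sin_nonneg_of_nonneg_of_le_pi hθ.1 hθ.2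
  rw [multBulk_eq_quadratic, abs_mul, abs_of_nonneg hs]
  have hQ := abs_quadratic₅_le (x := pd 0 G q) (y := pd 1 G q) (z := pd 2 G q) (g := G q)
    ((hK₁ _ hr _ hθ).trans (by linarith : K₁ ≤ K₁ + K₂ + K₃ + K₄ + K₅))
    ((hK₂ _ hr _ hθ).trans (by linarith : K₂ ≤ K₁ + K₂ + K₃ + K₄ + K₅))
    ((hK₃ _ hr _ hθ).trans (by linarith : K₃ ≤ K₁ + K₂ + K₃ + K₄ + K₅))
    ((hK₄ _ hr _ hθ).trans (by linarith : K₄ ≤ K₁ + K₂ + K₃ + K₄ + K₅))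
    ((hK₅ _ hr _ hθ).trans (by linarith : K₅ ≤ K₁ + K₂ + K₃ + K₄ + K₅))
  calc _ ≤ sin (q 2) * (2 * (K₁ + K₂ + K₃ + K₄ + K₅) *
        (pd 0 G q ^ 2 + pd 1 G q ^ 2 + pd 2 G q ^ 2 + G q ^ 2)) := mul_le_mul_of_nonneg_left hQ hs
    _ = _ := by ring

/-- **One-sided bound of the bulk without the angular derivative.** If, on `A ≤ r ≤ B`, the
coefficient `½f' − w` of `(∂_θG)²` in the bulk is `≤ 0` (a choice of the Lagrangian profile in the
transition region of the cut-off), then there the bulk is bounded ABOVE by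
`K sin θ ((∂_{t*}G)² + (∂_rG)² + G²)` — no angular derivative. (Upper bounds of the bulk are all
that the energy identity needs: `E_N(τ) ≤ E_N(0) + ∫∫∫ bulk`.) [cite: Aretakis2012, §13.1] -/
theorem exists_bound_multBulk_le (M a A B : ℝ) {f h w : ℝ → ℝ} (hf : ContDiff ℝ ∞ f)
    (hh : ContDiff ℝ ∞ h) (hw : ContDiff ℝ ∞ w) :
    ∃ K : ℝ, 0 ≤ K ∧ ∀ (G : E4 → ℝ) (q : E4), q 1 ∈ Icc A B → q 2 ∈ Icc 0 π →
      1 / 2 * deriv f (q 1) - w (q 1) ≤ 0 →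
      multBulk M a f h w G q ≤ K * (sin (q 2) * (pd 0 G q ^ 2 + pd 1 G q ^ 2 + G q ^ 2)) := by
  have cf : Continuous f := hf.continuous
  have cfr : Continuous (deriv f) := (contDiff_infty_iff_deriv.mp hf).2.continuous
  have chr : Continuous (deriv h) := (contDiff_infty_iff_deriv.mp hh).2.continuous
  have cw : Continuous w := hw.continuous
  have hw' := (contDiff_infty_iff_deriv.mp hw).2
  have cwr : Continuous (deriv w) := hw'.continuous
  have cwrr : Continuous (deriv (deriv w)) := (contDiff_infty_iff_deriv.mp hw').2.continuous
  obtain ⟨K₁, h₁0, hK₁⟩ := exists_abs_le_of_continuous (c := fun r θ ↦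
    1 / 2 * (f r * (2 * r - 2 * M) - deriv f r * (r ^ 2 - 2 * M * r + a ^ 2)) -
      w r * (r ^ 2 - 2 * M * r + a ^ 2)) (by fun_prop) A B
  obtain ⟨K₂, h₂0, hK₂⟩ := exists_abs_le_of_continuous (c := fun r (θ : ℝ) ↦
    2 * M * f r - deriv h r * (r ^ 2 - 2 * M * r + a ^ 2) - 4 * M * r * w r) (by fun_prop) A B
  obtain ⟨K₃, h₃0, hK₃⟩ := exists_abs_le_of_continuous (c := fun r θ ↦
    -(1 / 2 * (deriv f r * (r ^ 2 + a ^ 2 * cos θ ^ 2 + 2 * M * r) + f r * (2 * r + 2 * M))) -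
      deriv h r * (2 * M * r) + (r ^ 2 + a ^ 2 * cos θ ^ 2 + 2 * M * r) * w r) (by fun_prop) A B
  obtain ⟨K₅, h₅0, hK₅⟩ := exists_abs_le_of_continuous (c := fun r (θ : ℝ) ↦
    1 / 2 * (deriv (deriv w) r * (r ^ 2 - 2 * M * r + a ^ 2) + deriv w r * (2 * r - 2 * M)))
    (by fun_prop) A B
  refine ⟨2 * (K₁ + K₂ + K₃ + K₅), by positivity, fun G q hr hθ hsign ↦ ?_⟩
  have hs : 0 ≤ sin (q 2) := sin_nonneg_of_nonneg_of_le_pi hθ.1 hθ.2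
  rw [multBulk_eq_quadratic]
  -- drop the angular term (coefficient `≤ 0`) and bound the rest with `z = 0`
  have h4 : |(0 : ℝ)| ≤ K₁ + K₂ + K₃ + K₅ := by rw [abs_zero]; positivity
  have hQ := abs_quadratic₅_le (x := pd 0 G q) (y := pd 1 G q) (z := (0 : ℝ)) (g := G q)
    ((hK₁ _ hr _ hθ).trans (by linarith : K₁ ≤ K₁ + K₂ + K₃ + K₅))
    ((hK₂ _ hr _ hθ).trans (by linarith : K₂ ≤ K₁ + K₂ + K₃ + K₅))
    ((hK₃ _ hr _ hθ).trans (by linarith : K₃ ≤ K₁ + K₂ + K₃ + K₅)) h4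
    ((hK₅ _ hr _ hθ).trans (by linarith : K₅ ≤ K₁ + K₂ + K₃ + K₅))
  have hQ' := (le_abs_self _).trans hQ
  have hang : (1 / 2 * deriv f (q 1) - w (q 1)) * pd 2 G q ^ 2 ≤ 0 :=
    mul_nonpos_of_nonpos_of_nonneg hsign (sq_nonneg _)
  have hmain : (1 / 2 * (f (q 1) * (2 * q 1 - 2 * M) - deriv f (q 1) * (q 1 ^ 2 - 2 * M * q 1 + a ^ 2)) -
          w (q 1) * (q 1 ^ 2 - 2 * M * q 1 + a ^ 2)) * pd 1 G q ^ 2 +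
        (2 * M * f (q 1) - deriv h (q 1) * (q 1 ^ 2 - 2 * M * q 1 + a ^ 2) -
          4 * M * q 1 * w (q 1)) * pd 0 G q * pd 1 G q +
        (-(1 / 2 * (deriv f (q 1) * (q 1 ^ 2 + a ^ 2 * cos (q 2) ^ 2 + 2 * M * q 1) +
            f (q 1) * (2 * q 1 + 2 * M))) - deriv h (q 1) * (2 * M * q 1) +
          (q 1 ^ 2 + a ^ 2 * cos (q 2) ^ 2 + 2 * M * q 1) * w (q 1)) * pd 0 G q ^ 2 +
        (1 / 2 * deriv f (q 1) - w (q 1)) * pd 2 G q ^ 2 +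
        (1 / 2 * (deriv (deriv w) (q 1) * (q 1 ^ 2 - 2 * M * q 1 + a ^ 2) +
          deriv w (q 1) * (2 * q 1 - 2 * M))) * G q ^ 2 ≤
      2 * (K₁ + K₂ + K₃ + K₅) * (pd 0 G q ^ 2 + pd 1 G q ^ 2 + G q ^ 2) := by
    simp only [zero_pow two_ne_zero, mul_zero, add_zero] at hQ'
    linarith
  calc _ ≤ sin (q 2) * (2 * (K₁ + K₂ + K₃ + K₅) * (pd 0 G q ^ 2 + pd 1 G q ^ 2 + G q ^ 2)) :=
        mul_le_mul_of_nonneg_left hmain hs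
    _ = _ := by ring

/-- **The density of a multiplier with smooth profiles is bounded, on `A ≤ r ≤ B`, `θ ∈ [0, π]`,
by `K sin θ ((∂_{t*}G)² + (∂_rG)² + (∂_θG)² + G²)`.** [cite: Aretakis2012, §13.1] -/
theorem exists_bound_multDensity (M a A B : ℝ) {f h w : ℝ → ℝ} (hf : ContDiff ℝ ∞ f)
    (hh : ContDiff ℝ ∞ h) (hw : ContDiff ℝ ∞ w) :
    ∃ K : ℝ, 0 ≤ K ∧ ∀ (G : E4 → ℝ) (q : E4), q 1 ∈ Icc A B → q 2 ∈ Icc 0 π →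
      |multDensity M a f h w G q| ≤
        K * (sin (q 2) * (pd 0 G q ^ 2 + pd 1 G q ^ 2 + pd 2 G q ^ 2 + G q ^ 2)) := by
  have cf : Continuous f := hf.continuous
  have ch : Continuous h := hh.continuous
  have cw : Continuous w := hw.continuous
  obtain ⟨K₁, h₁0, hK₁⟩ := exists_abs_le_of_continuous (c := fun r (θ : ℝ) ↦
    f r * (2 * M * r) - 1 / 2 * h r * (r ^ 2 - 2 * M * r + a ^ 2)) (by fun_prop) A B
  obtain ⟨K₂, h₂0, hK₂⟩ := exists_abs_le_of_continuous (c := fun r θ ↦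
    -(f r * (r ^ 2 + a ^ 2 * cos θ ^ 2 + 2 * M * r))) (by fun_prop) A B
  obtain ⟨K₃, h₃0, hK₃⟩ := exists_abs_le_of_continuous (c := fun r θ ↦
    -(1 / 2 * h r * (r ^ 2 + a ^ 2 * cos θ ^ 2 + 2 * M * r))) (by fun_prop) A B
  obtain ⟨K₄, h₄0, hK₄⟩ := exists_abs_le_of_continuous (c := fun r (θ : ℝ) ↦
    -(1 / 2 * h r)) (by fun_prop) A B
  obtain ⟨K₅, h₅0, hK₅⟩ := exists_abs_le_of_continuous (c := fun r (θ : ℝ) ↦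
    4 * M * r * w r) (by fun_prop) A B
  obtain ⟨K₆, h₆0, hK₆⟩ := exists_abs_le_of_continuous (c := fun r (θ : ℝ) ↦ M * w r)
    (by fun_prop) A B
  obtain ⟨K₇, h₇0, hK₇⟩ := exists_abs_le_of_continuous (c := fun r θ ↦
    -((r ^ 2 + a ^ 2 * cos θ ^ 2 + 2 * M * r) * w r)) (by fun_prop) A B
  refine ⟨3 * (K₁ + K₂ + K₃ + K₄ + K₅ + K₆ + K₇), by positivity, fun G q hr hθ ↦ ?_⟩
  have hs : 0 ≤ sin (q 2) := sin_nonneg_of_nonneg_of_le_pi hθ.1 hθ.2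
  rw [multDensity_eq_quadratic, abs_mul, abs_of_nonneg hs]
  have hQ := abs_quadratic₇_le (x := pd 0 G q) (y := pd 1 G q) (z := pd 2 G q) (g := G q)
    ((hK₁ _ hr _ hθ).trans (by linarith : K₁ ≤ K₁ + K₂ + K₃ + K₄ + K₅ + K₆ + K₇))
    ((hK₂ _ hr _ hθ).trans (by linarith : K₂ ≤ K₁ + K₂ + K₃ + K₄ + K₅ + K₆ + K₇))
    ((hK₃ _ hr _ hθ).trans (by linarith : K₃ ≤ K₁ + K₂ + K₃ + K₄ + K₅ + K₆ + K₇))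
    ((hK₄ _ hr _ hθ).trans (by linarith : K₄ ≤ K₁ + K₂ + K₃ + K₄ + K₅ + K₆ + K₇))
    ((hK₅ _ hr _ hθ).trans (by linarith : K₅ ≤ K₁ + K₂ + K₃ + K₄ + K₅ + K₆ + K₇))
    ((hK₆ _ hr _ hθ).trans (by linarith : K₆ ≤ K₁ + K₂ + K₃ + K₄ + K₅ + K₆ + K₇))
    ((hK₇ _ hr _ hθ).trans (by linarith : K₇ ≤ K₁ + K₂ + K₃ + K₄ + K₅ + K₆ + K₇))
  calc _ ≤ sin (q 2) * (3 * (K₁ + K₂ + K₃ + K₄ + K₅ + K₆ + K₇) *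
        (pd 0 G q ^ 2 + pd 1 G q ^ 2 + pd 2 G q ^ 2 + G q ^ 2)) := mul_le_mul_of_nonneg_left hQ hs
    _ = _ := by ring

/-- **The degenerate `T`-energy density controls all derivatives away from the horizon**: for
`a = M`, `r ≥ A > M`, `θ ∈ [0, π]` and `m₀ = min(min((A − M)², A²), 1)`,
`m₀ sin θ ((∂_{t*}G)² + (∂_rG)² + (∂_θG)²) ≤ 2 e_T` (`Δ = (r − M)² ≥ (A − M)²`, `Σ ≥ r² ≥ A²`).
[cite: Aretakis2012, §5.1] -/
theorem sin_mul_sq_le_tEnergy {M A : ℝ} (hM : 0 < M) (hA : M < A) (G : E4 → ℝ) {q : E4}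
    (hr : A ≤ q 1) (hθ : q 2 ∈ Icc 0 π) :
    min (min ((A - M) ^ 2) (A ^ 2)) 1 * (sin (q 2) * (pd 0 G q ^ 2 + pd 1 G q ^ 2 + pd 2 G q ^ 2)) ≤
      2 * tEnergy M M G q := by
  have hs : 0 ≤ sin (q 2) := sin_nonneg_of_nonneg_of_le_pi hθ.1 hθ.2
  have hm1 : min (min ((A - M) ^ 2) (A ^ 2)) 1 ≤ (A - M) ^ 2 := (min_le_left _ _).trans (min_le_left _ _)
  have hm2 : min (min ((A - M) ^ 2) (A ^ 2)) 1 ≤ A ^ 2 := (min_le_left _ _).trans (min_le_right _ _)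
  have hm3 : min (min ((A - M) ^ 2) (A ^ 2)) 1 ≤ 1 := min_le_right _ _
  have hm0 : 0 ≤ min (min ((A - M) ^ 2) (A ^ 2)) 1 := le_min (le_min (sq_nonneg _) (sq_nonneg _)) zero_le_one
  have hΔ : (A - M) ^ 2 ≤ q 1 ^ 2 - 2 * M * q 1 + M ^ 2 := by nlinarith
  have hSig : A ^ 2 ≤ q 1 ^ 2 + M ^ 2 * cos (q 2) ^ 2 + 2 * M * q 1 := by
    nlinarith [sq_nonneg (M * cos (q 2)), mul_pos hM (hM.trans (hA.trans_le hr))]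
  simp only [tEnergy]
  set m := min (min ((A - M) ^ 2) (A ^ 2)) 1
  nlinarith [mul_nonneg hs (mul_nonneg (sub_nonneg.mpr (hm1.trans hΔ)) (sq_nonneg (pd 1 G q))),
    mul_nonneg hs (mul_nonneg (sub_nonneg.mpr (hm2.trans hSig)) (sq_nonneg (pd 0 G q))),
    mul_nonneg hs (mul_nonneg (sub_nonneg.mpr hm3) (sq_nonneg (pd 2 G q)))]

/-! ### The collar `M ≤ r ≤ 23M/21`: sign of the bulk and coercivity of the `N`-energy -/

/-- **On the collar the bulk of `J^{N,−1/2}` is non-positive** (in the convention of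
`mult_box_identity`, `K^{N,−1/2}ρ² sin θ = −multBulk ≥ 0`, Prop. 7.2.1).
[cite: Aretakis2012, §7.2 (Prop. 7.2.1)] -/
theorem multBulk_nCurrent_nonpos {M : ℝ} (hM : 0 < M) (G : E4 → ℝ) {q : E4} (hr : M ≤ q 1)
    (hr' : q 1 ≤ 23 / 21 * M) (hθ : q 2 ∈ Icc 0 π) :
    multBulk M M (nProfileR M) (nProfileT M) nProfileW G q ≤ 0 := by
  have h := neg_multBulk_nCurrent_ge hM G hr hr' hθ
  have hs : 0 ≤ sin (q 2) := sin_nonneg_of_nonneg_of_le_pi hθ.1 hθ.2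
  have h1 : 0 ≤ 1 / 4 * (q 1 - M) * (q 1 + M) * pd 1 G q ^ 2 :=
    mul_nonneg (mul_nonneg (mul_nonneg (by norm_num) (by linarith)) (by linarith)) (sq_nonneg _)
  have h2 : 0 ≤ 18 * M ^ 2 * pd 0 G q ^ 2 := by positivity
  have h3 : 0 ≤ 1 / 2 * pd 2 G q ^ 2 := by positivity
  nlinarith [mul_nonneg hs (add_nonneg (add_nonneg h1 h2) h3)]

/-- **Coercivity of the `N`-energy density on the collar, zeroth-order terms split off**: for
`M ≤ r ≤ 23M/21`, `θ ∈ [0, π]`,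
`(M³/16) sin θ (∂_rG)² ≤ E_N + 70M sin θ G²`, `E_N = −multDensity` — from `nEnergy_quadratic_ge`
(`E_N ≥ sin θ (M³/8 (∂_rG)² + h Σ/16 (∂_{t*}G)² + ½h(∂_θG)²) + ½ sin θ (4Mr G∂_rG + M G² − Σ G∂_{t*}G)`,
`h ≥ 3M/2`) by absorbing the cross terms: `M³/16 x² + 2Mr gx + 64M g² ≥ 0` (`r ≤ 2M`) and
`(3M/32)Σ y² − ½Σ gy + 6M g² ≥ 0` (`Σ ≤ 9M²`). In §13.1 the term `sin θ G²` is then removed by the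
first Hardy inequality. [cite: Aretakis2012, §7.2 and §13.1] -/
theorem nEnergy_collar_ge {M : ℝ} (hM : 0 < M) (G : E4 → ℝ) {q : E4} (hr : M ≤ q 1)
    (hr' : q 1 ≤ 23 / 21 * M) (hθ : q 2 ∈ Icc 0 π) :
    M ^ 3 / 16 * (sin (q 2) * pd 1 G q ^ 2) ≤
      -multDensity M M (nProfileR M) (nProfileT M) nProfileW G q + 70 * M * (sin (q 2) * G q ^ 2) := by
  have h := nEnergy_quadratic_ge hM G hr hr' hθ
  have hs : 0 ≤ sin (q 2) := sin_nonneg_of_nonneg_of_le_pi hθ.1 hθ.2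
  have hcc1 : cos (q 2) ^ 2 ≤ 1 := by
    have := sin_sq_add_cos_sq (q 2); nlinarith [sq_nonneg (sin (q 2))]
  have hSig0 : 0 ≤ q 1 ^ 2 + M ^ 2 * cos (q 2) ^ 2 + 2 * M * q 1 := by nlinarith [mul_pos hM hM]
  have hSig9 : q 1 ^ 2 + M ^ 2 * cos (q 2) ^ 2 + 2 * M * q 1 ≤ 9 * M ^ 2 := by nlinarith [mul_pos hM hM]
  have hhT : 0 ≤ 20 * q 1 - 37 / 2 * M - 3 / 2 * M := by linarith
  -- the two absorbing quadratic forms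
  have hQ1 : 0 ≤ M ^ 3 / 16 * pd 1 G q ^ 2 + 2 * M * q 1 * G q * pd 1 G q + 64 * M * G q ^ 2 := by
    refine quadForm_nonneg (by positivity) (by positivity) ?_
    have hq2 : q 1 ^ 2 ≤ (23 / 21 * M) ^ 2 := pow_le_pow_left₀ (by linarith) hr' 2
    nlinarith [mul_pos hM hM, pow_pos hM 4, mul_nonneg (mul_pos hM hM).le (sub_nonneg.mpr hq2)]
  have hQ2 : 0 ≤ 3 * M / 32 * (q 1 ^ 2 + M ^ 2 * cos (q 2) ^ 2 + 2 * M * q 1) * pd 0 G q ^ 2 +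
      -(1 / 2 * (q 1 ^ 2 + M ^ 2 * cos (q 2) ^ 2 + 2 * M * q 1)) * G q * pd 0 G q + 6 * M * G q ^ 2 := by
    refine quadForm_nonneg (by positivity) (by positivity) ?_
    nlinarith [mul_nonneg hSig0 (sub_nonneg.mpr hSig9), mul_pos hM hM]
  nlinarith [h, mul_nonneg hs hQ1, mul_nonneg hs hQ2,
    mul_nonneg hs (mul_nonneg (mul_nonneg hhT hSig0) (sq_nonneg (pd 0 G q))),
    mul_nonneg hs (mul_nonneg hhT (sq_nonneg (pd 2 G q))),
    mul_nonneg hs (mul_nonneg hM.le (sq_nonneg (pd 2 G q))),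
    mul_nonneg hs (mul_nonneg hM.le (sq_nonneg (G q)))]

end Literature.Barriers.FinalStateConjecture.Kerr

end
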